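/-
Copyright: the b2b-balaban T⁴-continuum CRUX team, row NE7b leaf lineage `t4-ne7b-formalise-leaf-03` (gen 156). Project licence.
-/
import Mathlib.Analysis.Calculus.FDeriv.Mul
import Mathlib.Analysis.Calculus.Deriv.Comp
import Summits.QuantumFields.BalabanUV.T4Continuum.Spine.NE7b.HardStepActionHessian

/-!
# THE VARIATIONAL JUNCTION ON A FINITE CARRIER: for the action `S φ = ½Σ_x φ x·(At φ) x + Σ_x v(φ x)` on `ι → ℝ` (`ι` finite,
# `At` with a SYMMETRIC form, `v′ = u`) and a background branch `σt : (κ → ℝ) → (ι → ℝ)` with response `Dt`, block mean `Qt`,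
# `Qt ∘ Dt = 1`, whose value `σt w` solves THE SITEWISE EQUATION IN PAIRING FORM «`At(σt w) + u∘(σt w)` pairs like the block lift of
# a coarse field `c`: `Σ_x (At(σt w) x + u(σt w x))·h x = vol·Σ_y c y·(Qt h) y`» — the EFFECTIVE ACTION `S ∘ σt` has derivative
# `k ↦ vol·Σ_y c y·k y` (THE GRADIENT IS THE BLOCK VOLUME TIMES THE NEXT EQUATION MAP), `DS(σt w)` kills `ker Qt`
# (fibre-criticality), and by `…HardStepActionHessian` its Hessian is `S″(σt w)[Dt·, Dt·]`, read through the LINEARISED fibre letter as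
# `vol·Σ_y (Mt k) y·k′ y` with `Mt = Qt(At + u′(σt w)·)Dt` the next-scale operator
# (row NE7b, node U5c; HSAH `hasFDerivAt_fderiv_comp_branch` BY NAME, Mathlib calculus; [folklore])

Cell `pub-balaban`, sub-cell `t4`, spine estimate NE7b (`T4WeightBudget.RelWeightBound`; the cell's OWN estimate — NOT PRINTED in
[Bałaban 1983–89], NOT PROVED).  Crux-route work under `Spine/NE7b/` by a row leaf (`t4-ne7b-formalise-leaf-03` gen 156) under
FREEZE (0)'s crux-prover clause, on the row OWNER's located item ([NE7bP1-G116-HANDOFF] NEXT (3)(iii): «the variational junction on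
the torus (effective action `V∘σt`, its gradient = SISL's next equation map × block volume, its Hessian = (65)'s next-scale operator)
— leaf-06's HardStep road has it ABSTRACTLY (HSAH), an instance needs the torus Dirichlet form on leaf-03's `Site` carriers»);
NOTHING of Bałaban's is named as a Lean object, valued or asserted; no `T4Continuum/Support` leaf typed; no `def`, no notation (the
action is written out; every covector ∕ bilinear form enters as ANY continuous (bi)linear map WITH THE DISPLAYED ACTION, and §1 shows
such maps exist); zero `sorry`.  Imports: Mathlib (`HasFDerivAt.mul ∕ .sum ∕ .smul_const ∕ .const_mul`, `HasDerivAt.comp_hasFDerivAt`,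
`ContinuousLinearMap.proj`) and leaf-04's `…HardStepActionHessian` (HSAH: `hasFDerivAt_fderiv_comp_branch`, Mathlib-only) — NO lattice
module: the file is GENERIC in the finite carriers `ι` (fine torus) and `κ` (coarse torus) and independent of the `Spine/NE7b` olean
frontier.  The INSTANCE on the `Beta.Site` carriers — `At := Rf∘A∘Ef` symmetric by this lineage's `…SupTorusDirichletForm.torus_form_symm`
(TDF §3), the pairing letter by TDF §2 `sum_blockLift_mul_eq_blockAvg` + `apply_windowMap_of_blockConst` at SBTL's sitewise equation,
`σt ∕ Dt ∕ Qt∘Dt = 1` by SBTL `exists_background_torus_localised` (SLT's `Dt := Rf∘Dσ∘Ec`) — is the successor file (it needs SBTL's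
hub olean); nothing of it is restated here.

WHY (located).  HSAH types the second-order envelope theorem for a `C¹` critical branch in Banach spaces, with the action `V`, the
block mean `D`, the branch `σ` and the fibre-criticality `DV(σ w′) κ = 0 (D κ = 0)` as letters; SISL types the next equation map
`w ↦ Q′(A(σ w) + Nu(σ w))` on `ℓ^∞(ℤ^d)`, where NO action functional exists (the lattice sum diverges).  On a torus the action IS a
finite sum, and the two roads meet: this file writes the action out on a finite carrier, differentiates it twice (§1–§2), and shows
(§3) that the background's sitewise equation — in the pairing form TDF §2 gives it on the `Beta.Site` carriers — is EXACTLY HSAH's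
fibre-criticality AND evaluates the chain-rule derivative of `S∘σt` on the response to `vol·⟨c, k⟩`: the gradient of the effective
action is the block volume times the next equation map.  §4 feeds HSAH and reads the transported Hessian through the linearised
fibre letter as the next-scale operator's form.

WHAT IS PROVED ([folklore]; `ι κ` finite types, carriers `ι → ℝ`, `κ → ℝ` with Mathlib's Pi norm — PTC's torus sup carriers):
* §1 `exists_clm_pair` (`h ↦ Σ_x g x·h x` is a continuous covector), `exists_clm_pairForm` (`(k, k′) ↦ Σ_x ((At k) x + g x·k x)·k′ x`
  is a continuous bilinear form), **`hasFDerivAt_form`** (`At` symmetric ⟹ `D(Σ φ·Atφ)(φ) = 2Σ (Atφ)·–`), **`hasFDerivAt_potential`**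
  (`D(Σ v∘φ)(φ) = Σ u(φ)·–`), **`hasFDerivAt_action`** (`DS(φ) h = Σ_x ((At φ) x + u(φ x))·h x`), `fderiv_action_apply`,
  `differentiableAt_action`.
* §2 **`hasFDerivAt_fderiv_action`** (`u′` exists ⟹ `HasFDerivAt (fderiv S) (S″ φ) φ` with `S″ φ k k′ = Σ_x ((At k) x + u′(φ x)·k x)·k′ x`
  for ANY bilinear map with that action).
* §3 **`fderiv_action_eq_zero_of_pairing`** (the sitewise equation in pairing form ⟹ `DS(φ)` kills `ker Qt` — HSAH's `hcrit`),
  **`hasFDerivAt_effectiveAction`** (THE GRADIENT OF THE EFFECTIVE ACTION: `HasFDerivAt σt Dt w`, `Qt∘Dt = 1`, pairing letter with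
  `(vol, c)` ⟹ `HasFDerivAt (S∘σt) (vol • ⟨c, –⟩) w`), `fderiv_effectiveAction_apply` (`D(S∘σt)(w) k = vol·Σ_y c y·k y`).
* §4 **`hasFDerivAt_fderiv_effectiveAction`** (HSAH fed: along a neighbourhood the branch is `C¹` with `Qt∘Dt(w′) = 1` and the pairing
  letter holds at every `σt w′`; `u′` exists ⟹ `HasFDerivAt (fderiv (S∘σt)) ((S″(σt w)).bilinearComp (Dt w) (Dt w)) w`),
  **`hessian_effectiveAction_apply_of_linearised`** (with the LINEARISED fibre letter «`(At + u′(σt w)·)(Dt k)` pairs like the block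
  lift of `Mt k`»: `(S∘σt)″(w) k k′ = vol·Σ_y (Mt k) y·k′ y` — THE HESSIAN IS THE BLOCK VOLUME TIMES THE NEXT-SCALE OPERATOR'S FORM).
* §5 toy: `ι = κ = Unit`, `At = 0`, `v = 0`, `σt = id`.

HONEST (what this is NOT).  Finite-dimensional calculus, letters in ∕ letters out: the pairing letters, `Qt∘Dt = 1` and the branch's
differentiability are HYPOTHESES here (discharged on the `Beta.Site` carriers by TDF + SBTL + SLT in the successor instance file, not in
this one); no estimate, no constant, no convexity ∕ minimality (criticality only); `vol`, `c`, `Mt` are whatever the letters say (on the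
torus: `(n+1)^d`, `Rc(Q′(A(Ef σt w) + u∘(Ef σt w)))`, `Rc∘Q′(A + N′)Dσ∘Ec`); scalar skeleton, not the covariant operators ((A3),
NC-NE7b-α UNRULED); nothing of Bałaban's.  BY-NAME EFFECT ON THE WALL: NONE.  NE7b NOT PRINTED ∕ NOT PROVED; spine PROVED 0∕9; rung
(B)+1 on a FINITE torus — NOT infinite volume, NOT the mass gap, NOT Clay.  HONEST DEPENDENCY: continuum YM on T⁴ ⇐ BetaPertH ∧ nine
spine estimates (0∕9 proved); BetaPertH ⇐ (D1) ∧ (D4) ∧ CAP+tail; G-an2-4 gates asym, D1 and NE2∕3∕4.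
-/

set_option autoImplicit false

noncomputable section

namespace Summit.QuantumFields.BalabanUV.T4Continuum.NE7b.SupTorusEffectiveAction

open Set Filter Topology Function
open HardStepActionHessian (hasFDerivAt_fderiv_comp_branch)

variable {ι κ : Type*} [Fintype ι] [Fintype κ]

/-! ## §1. The action on a finite carrier and its first derivative -/

/-- The pairing covector `h ↦ Σ_x g x·h x` is a continuous linear map on `ι → ℝ`. [folklore] -/
theorem exists_clm_pair (g : ι → ℝ) : ∃ L : (ι → ℝ) →L[ℝ] ℝ, ∀ h : ι → ℝ, L h = ∑ x, g x * h x :=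
  ⟨∑ x, g x • ContinuousLinearMap.proj (R := ℝ) (φ := fun _ : ι => ℝ) x, fun h => by
    simp only [sum_apply, smul_apply,
      ContinuousLinearMap.proj_apply, smul_eq_mul]⟩

/-- The form `(k, k′) ↦ Σ_x ((At k) x + g x·k x)·k′ x` is a continuous bilinear map on `ι → ℝ`. [folklore] -/
theorem exists_clm_pairForm (At : (ι → ℝ) →L[ℝ] (ι → ℝ)) (g : ι → ℝ) :
    ∃ H : (ι → ℝ) →L[ℝ] (ι → ℝ) →L[ℝ] ℝ, ∀ k k' : ι → ℝ, H k k' = ∑ x, (At k x + g x * k x) * k' x :=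
  ⟨∑ x, (((ContinuousLinearMap.proj (R := ℝ) (φ := fun _ : ι => ℝ) x).comp At)
      + g x • ContinuousLinearMap.proj (R := ℝ) (φ := fun _ : ι => ℝ) x).smulRight
        (ContinuousLinearMap.proj (R := ℝ) (φ := fun _ : ι => ℝ) x), fun k k' => by
    simp only [sum_apply, ContinuousLinearMap.smulRight_apply,
      add_apply, ContinuousLinearMap.coe_comp, comp_apply, ContinuousLinearMap.proj_apply,
      smul_apply, smul_eq_mul]⟩

/-- **THE QUADRATIC FORM OF A SYMMETRIC OPERATOR**: if `Σ_x ψ x·(At φ) x = Σ_x φ x·(At ψ) x` for all `φ ψ`, then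
`φ ↦ Σ_x φ x·(At φ) x` has derivative `2·Σ_x (At φ) x·–` (for ANY covector with that action). [folklore] -/
theorem hasFDerivAt_form (At : (ι → ℝ) →L[ℝ] (ι → ℝ)) (hAt : ∀ φ ψ : ι → ℝ, ∑ x, ψ x * At φ x = ∑ x, φ x * At ψ x)
    (φ : ι → ℝ) {L : (ι → ℝ) →L[ℝ] ℝ} (hL : ∀ h : ι → ℝ, L h = ∑ x, At φ x * h x) :
    HasFDerivAt (fun φ : ι → ℝ => ∑ x, φ x * At φ x) ((2 : ℝ) • L) φ := by
  have hterm : ∀ x ∈ (Finset.univ : Finset ι), HasFDerivAt (fun φ : ι → ℝ => φ x * At φ x)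
      (φ x • (ContinuousLinearMap.proj (R := ℝ) (φ := fun _ : ι => ℝ) x).comp At
        + At φ x • ContinuousLinearMap.proj (R := ℝ) (φ := fun _ : ι => ℝ) x) φ := fun x _ =>
    (ContinuousLinearMap.proj (R := ℝ) (φ := fun _ : ι => ℝ) x).hasFDerivAt.mul
      ((ContinuousLinearMap.proj (R := ℝ) (φ := fun _ : ι => ℝ) x).comp At).hasFDerivAt
  refine (HasFDerivAt.fun_sum hterm).congr_fderiv (ContinuousLinearMap.ext fun h => ?_)
  simp only [sum_apply, add_apply, smul_apply,
    ContinuousLinearMap.coe_comp, comp_apply, ContinuousLinearMap.proj_apply, smul_eq_mul,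
    Finset.sum_add_distrib, hL]
  rw [hAt h φ, two_mul]
  congr 1
  exact Finset.sum_congr rfl fun x _ => mul_comm _ _

/-- **THE SITEWISE POTENTIAL**: if `v′ = u` then `φ ↦ Σ_x v(φ x)` has derivative `Σ_x u(φ x)·–`. [folklore] -/
theorem hasFDerivAt_potential {v u : ℝ → ℝ} (hv : ∀ t, HasDerivAt v (u t) t) (φ : ι → ℝ)
    {L : (ι → ℝ) →L[ℝ] ℝ} (hL : ∀ h : ι → ℝ, L h = ∑ x, u (φ x) * h x) :
    HasFDerivAt (fun φ : ι → ℝ => ∑ x, v (φ x)) L φ := by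
  have hterm : ∀ x ∈ (Finset.univ : Finset ι), HasFDerivAt (fun φ : ι → ℝ => v (φ x))
      (u (φ x) • ContinuousLinearMap.proj (R := ℝ) (φ := fun _ : ι => ℝ) x) φ := fun x _ =>
    (hv (φ x)).comp_hasFDerivAt φ (ContinuousLinearMap.proj (R := ℝ) (φ := fun _ : ι => ℝ) x).hasFDerivAt
  refine (HasFDerivAt.fun_sum hterm).congr_fderiv (ContinuousLinearMap.ext fun h => ?_)
  simp only [sum_apply, smul_apply,
    ContinuousLinearMap.proj_apply, smul_eq_mul, hL]

/-- **THE ACTION'S DIFFERENTIAL**: for `At` with a symmetric form and `v′ = u`, `S φ = ½Σ_x φ x·(At φ) x + Σ_x v(φ x)` has derivative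
`h ↦ Σ_x ((At φ) x + u(φ x))·h x` at every `φ` — the field equation `At φ + u∘φ` as a covector. [folklore] -/
theorem hasFDerivAt_action (At : (ι → ℝ) →L[ℝ] (ι → ℝ)) (hAt : ∀ φ ψ : ι → ℝ, ∑ x, ψ x * At φ x = ∑ x, φ x * At ψ x)
    {v u : ℝ → ℝ} (hv : ∀ t, HasDerivAt v (u t) t) (φ : ι → ℝ)
    {L : (ι → ℝ) →L[ℝ] ℝ} (hL : ∀ h : ι → ℝ, L h = ∑ x, (At φ x + u (φ x)) * h x) :
    HasFDerivAt (fun φ : ι → ℝ => (1 / 2 : ℝ) * ∑ x, φ x * At φ x + ∑ x, v (φ x)) L φ := by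
  obtain ⟨L1, hL1⟩ := exists_clm_pair (fun x => At φ x)
  obtain ⟨L2, hL2⟩ := exists_clm_pair (fun x => u (φ x))
  have h1 := (hasFDerivAt_form At hAt φ hL1).const_mul (1 / 2 : ℝ)
  have h2 := hasFDerivAt_potential hv φ hL2
  refine (h1.add h2).congr_fderiv (ContinuousLinearMap.ext fun h => ?_)
  simp only [add_apply, smul_apply, smul_eq_mul, hL1, hL2, hL]
  rw [← mul_assoc, show (1 / 2 : ℝ) * 2 = 1 by norm_num, one_mul, ← Finset.sum_add_distrib]
  exact Finset.sum_congr rfl fun x _ => by ring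

/-- `fderiv` form: `fderiv S φ h = Σ_x ((At φ) x + u(φ x))·h x`. [folklore] -/
theorem fderiv_action_apply (At : (ι → ℝ) →L[ℝ] (ι → ℝ)) (hAt : ∀ φ ψ : ι → ℝ, ∑ x, ψ x * At φ x = ∑ x, φ x * At ψ x)
    {v u : ℝ → ℝ} (hv : ∀ t, HasDerivAt v (u t) t) (φ h : ι → ℝ) :
    fderiv ℝ (fun φ : ι → ℝ => (1 / 2 : ℝ) * ∑ x, φ x * At φ x + ∑ x, v (φ x)) φ h = ∑ x, (At φ x + u (φ x)) * h x := by
  obtain ⟨L, hL⟩ := exists_clm_pair (fun x => At φ x + u (φ x))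
  rw [(hasFDerivAt_action At hAt hv φ hL).fderiv, hL]

/-- The action is differentiable everywhere. [folklore] -/
theorem differentiableAt_action (At : (ι → ℝ) →L[ℝ] (ι → ℝ)) (hAt : ∀ φ ψ : ι → ℝ, ∑ x, ψ x * At φ x = ∑ x, φ x * At ψ x)
    {v u : ℝ → ℝ} (hv : ∀ t, HasDerivAt v (u t) t) (φ : ι → ℝ) :
    DifferentiableAt ℝ (fun φ : ι → ℝ => (1 / 2 : ℝ) * ∑ x, φ x * At φ x + ∑ x, v (φ x)) φ := by
  obtain ⟨L, hL⟩ := exists_clm_pair (fun x => At φ x + u (φ x))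
  exact (hasFDerivAt_action At hAt hv φ hL).differentiableAt

/-! ## §2. The second derivative of the action -/

/-- **THE ACTION IS TWICE DIFFERENTIABLE WHERE `u′` EXISTS**: `HasFDerivAt (fderiv S) (S″ φ) φ` with
`S″ φ k k′ = Σ_x ((At k) x + u′(φ x)·k x)·k′ x`, for ANY continuous bilinear map with that action — the linearised field operator
`At + u′(φ)·` as a form. [folklore] -/
theorem hasFDerivAt_fderiv_action (At : (ι → ℝ) →L[ℝ] (ι → ℝ))
    (hAt : ∀ φ ψ : ι → ℝ, ∑ x, ψ x * At φ x = ∑ x, φ x * At ψ x)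
    {v u u' : ℝ → ℝ} (hv : ∀ t, HasDerivAt v (u t) t) (hu : ∀ t, HasDerivAt u (u' t) t) (φ : ι → ℝ)
    {H : (ι → ℝ) →L[ℝ] (ι → ℝ) →L[ℝ] ℝ} (hH : ∀ k k' : ι → ℝ, H k k' = ∑ x, (At k x + u' (φ x) * k x) * k' x) :
    HasFDerivAt (fderiv ℝ (fun φ : ι → ℝ => (1 / 2 : ℝ) * ∑ x, φ x * At φ x + ∑ x, v (φ x))) H φ := by
  -- the differential as a function of the base point: `φ′ ↦ Σ_x ((At φ′) x + u(φ′ x)) • proj x`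
  have hD : fderiv ℝ (fun φ : ι → ℝ => (1 / 2 : ℝ) * ∑ x, φ x * At φ x + ∑ x, v (φ x))
      = fun φ' : ι → ℝ => ∑ x, (At φ' x + u (φ' x)) • ContinuousLinearMap.proj (R := ℝ) (φ := fun _ : ι => ℝ) x := by
    funext φ'
    refine (hasFDerivAt_action At hAt hv φ' fun h => ?_).fderiv
    simp only [sum_apply, smul_apply,
      ContinuousLinearMap.proj_apply, smul_eq_mul]
  rw [hD]
  have hterm : ∀ x ∈ (Finset.univ : Finset ι),
      HasFDerivAt (fun φ' : ι → ℝ => (At φ' x + u (φ' x)) • ContinuousLinearMap.proj (R := ℝ) (φ := fun _ : ι => ℝ) x)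
        (((ContinuousLinearMap.proj (R := ℝ) (φ := fun _ : ι => ℝ) x).comp At
          + u' (φ x) • ContinuousLinearMap.proj (R := ℝ) (φ := fun _ : ι => ℝ) x).smulRight
          (ContinuousLinearMap.proj (R := ℝ) (φ := fun _ : ι => ℝ) x)) φ := fun x _ =>
    (((ContinuousLinearMap.proj (R := ℝ) (φ := fun _ : ι => ℝ) x).comp At).hasFDerivAt.add
      ((hu (φ x)).comp_hasFDerivAt φ (ContinuousLinearMap.proj (R := ℝ) (φ := fun _ : ι => ℝ) x).hasFDerivAt)).smul_const
      (ContinuousLinearMap.proj (R := ℝ) (φ := fun _ : ι => ℝ) x)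
  refine (HasFDerivAt.fun_sum hterm).congr_fderiv (ContinuousLinearMap.ext fun k => ContinuousLinearMap.ext fun k' => ?_)
  simp only [sum_apply, ContinuousLinearMap.smulRight_apply,
    add_apply, ContinuousLinearMap.coe_comp, comp_apply, ContinuousLinearMap.proj_apply,
    smul_apply, smul_eq_mul, hH]

/-! ## §3. Fibre-criticality and the gradient of the effective action -/

/-- **THE SITEWISE EQUATION IN PAIRING FORM IS FIBRE-CRITICALITY**: if the field equation at `φ` pairs like a block lift
(`Σ_x ((At φ) x + u(φ x))·h x = vol·Σ_y c y·(Qt h) y` for every `h`), then `DS(φ)` kills `ker Qt` — `…HardStepActionHessian`'s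
`hcrit`. [folklore] -/
theorem fderiv_action_eq_zero_of_pairing (At : (ι → ℝ) →L[ℝ] (ι → ℝ))
    (hAt : ∀ φ ψ : ι → ℝ, ∑ x, ψ x * At φ x = ∑ x, φ x * At ψ x)
    {v u : ℝ → ℝ} (hv : ∀ t, HasDerivAt v (u t) t) (Qt : (ι → ℝ) →L[ℝ] (κ → ℝ)) {φ : ι → ℝ} {vol : ℝ} {c : κ → ℝ}
    (hpair : ∀ h : ι → ℝ, ∑ x, (At φ x + u (φ x)) * h x = vol * ∑ y, c y * Qt h y)
    (h : ι → ℝ) (hh : Qt h = 0) :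
    fderiv ℝ (fun φ : ι → ℝ => (1 / 2 : ℝ) * ∑ x, φ x * At φ x + ∑ x, v (φ x)) φ h = 0 := by
  rw [fderiv_action_apply At hAt hv, hpair, hh]
  simp

/-- **THE GRADIENT OF THE EFFECTIVE ACTION IS THE BLOCK VOLUME TIMES THE NEXT EQUATION MAP.**  Let `σt` have derivative `Dt` at `w`
with `Qt (Dt k) = k` (a section of the block mean), and let the field equation at `σt w` pair like the block lift of `c`
(`Σ_x ((At(σt w)) x + u(σt w x))·h x = vol·Σ_y c y·(Qt h) y`).  Then `S ∘ σt` has derivative `vol • ⟨c, –⟩` at `w`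
(for ANY covector with the action `k ↦ Σ_y c y·k y`). [folklore] -/
theorem hasFDerivAt_effectiveAction (At : (ι → ℝ) →L[ℝ] (ι → ℝ))
    (hAt : ∀ φ ψ : ι → ℝ, ∑ x, ψ x * At φ x = ∑ x, φ x * At ψ x)
    {v u : ℝ → ℝ} (hv : ∀ t, HasDerivAt v (u t) t) (σt : (κ → ℝ) → (ι → ℝ)) {w : κ → ℝ} {Dt : (κ → ℝ) →L[ℝ] (ι → ℝ)}
    (hσ : HasFDerivAt σt Dt w) (Qt : (ι → ℝ) →L[ℝ] (κ → ℝ)) (hsec : ∀ k : κ → ℝ, Qt (Dt k) = k) {vol : ℝ} {c : κ → ℝ}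
    (hpair : ∀ h : ι → ℝ, ∑ x, (At (σt w) x + u (σt w x)) * h x = vol * ∑ y, c y * Qt h y)
    {Lc : (κ → ℝ) →L[ℝ] ℝ} (hLc : ∀ k : κ → ℝ, Lc k = ∑ y, c y * k y) :
    HasFDerivAt (fun w' : κ → ℝ => (1 / 2 : ℝ) * ∑ x, σt w' x * At (σt w') x + ∑ x, v (σt w' x)) (vol • Lc) w := by
  obtain ⟨L, hL⟩ := exists_clm_pair (fun x => At (σt w) x + u (σt w x))
  have hc := (hasFDerivAt_action At hAt hv (σt w) hL).comp w hσ
  refine hc.congr_fderiv (ContinuousLinearMap.ext fun k => ?_)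
  rw [ContinuousLinearMap.comp_apply, hL, hpair, hsec, smul_apply, hLc, smul_eq_mul]

/-- `fderiv` form: `D(S∘σt)(w) k = vol·Σ_y c y·k y`. [folklore] -/
theorem fderiv_effectiveAction_apply (At : (ι → ℝ) →L[ℝ] (ι → ℝ))
    (hAt : ∀ φ ψ : ι → ℝ, ∑ x, ψ x * At φ x = ∑ x, φ x * At ψ x)
    {v u : ℝ → ℝ} (hv : ∀ t, HasDerivAt v (u t) t) (σt : (κ → ℝ) → (ι → ℝ)) {w : κ → ℝ} {Dt : (κ → ℝ) →L[ℝ] (ι → ℝ)}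
    (hσ : HasFDerivAt σt Dt w) (Qt : (ι → ℝ) →L[ℝ] (κ → ℝ)) (hsec : ∀ k : κ → ℝ, Qt (Dt k) = k) {vol : ℝ} {c : κ → ℝ}
    (hpair : ∀ h : ι → ℝ, ∑ x, (At (σt w) x + u (σt w x)) * h x = vol * ∑ y, c y * Qt h y) (k : κ → ℝ) :
    fderiv ℝ (fun w' : κ → ℝ => (1 / 2 : ℝ) * ∑ x, σt w' x * At (σt w') x + ∑ x, v (σt w' x)) w k = vol * ∑ y, c y * k y := by
  obtain ⟨Lc, hLc⟩ := exists_clm_pair c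
  rw [(hasFDerivAt_effectiveAction At hAt hv σt hσ Qt hsec hpair hLc).fderiv, smul_apply,
    hLc, smul_eq_mul]

/-! ## §4. The Hessian of the effective action: HSAH fed, and read through the linearised fibre letter -/

/-- **THE HESSIAN OF THE EFFECTIVE ACTION IS THE TRANSPORTED HESSIAN** (HSAH `hasFDerivAt_fderiv_comp_branch` fed with §1–§3): on a
neighbourhood `s` of `w` let `σt` have derivative `Dt w′` with `Qt (Dt w′ k) = k`, and let the field equation at every `σt w′` pair
like a block lift (criticality along the branch); let `u′` exist.  Then `fderiv (S∘σt)` has derivative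
`(S″(σt w)).bilinearComp (Dt w) (Dt w)` at `w`, for ANY bilinear map `S″(σt w)` with the action of §2. [folklore] -/
theorem hasFDerivAt_fderiv_effectiveAction (At : (ι → ℝ) →L[ℝ] (ι → ℝ))
    (hAt : ∀ φ ψ : ι → ℝ, ∑ x, ψ x * At φ x = ∑ x, φ x * At ψ x)
    {v u u' : ℝ → ℝ} (hv : ∀ t, HasDerivAt v (u t) t) (hu : ∀ t, HasDerivAt u (u' t) t)
    (σt : (κ → ℝ) → (ι → ℝ)) {Dt : (κ → ℝ) → (κ → ℝ) →L[ℝ] (ι → ℝ)} (Qt : (ι → ℝ) →L[ℝ] (κ → ℝ))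
    {s : Set (κ → ℝ)} {w : κ → ℝ} (hs : s ∈ 𝓝 w)
    (hσ : ∀ w' ∈ s, HasFDerivAt σt (Dt w') w') (hsec : ∀ w' ∈ s, ∀ k : κ → ℝ, Qt (Dt w' k) = k) {vol : ℝ}
    (hpair : ∀ w' ∈ s, ∃ c : κ → ℝ, ∀ h : ι → ℝ, ∑ x, (At (σt w') x + u (σt w' x)) * h x = vol * ∑ y, c y * Qt h y)
    {H : (ι → ℝ) →L[ℝ] (ι → ℝ) →L[ℝ] ℝ} (hH : ∀ k k' : ι → ℝ, H k k' = ∑ x, (At k x + u' (σt w x) * k x) * k' x) :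
    HasFDerivAt (fderiv ℝ ((fun φ : ι → ℝ => (1 / 2 : ℝ) * ∑ x, φ x * At φ x + ∑ x, v (φ x)) ∘ σt))
      (H.bilinearComp (Dt w) (Dt w)) w :=
  hasFDerivAt_fderiv_comp_branch Qt hs hσ hsec (fun w' _ => differentiableAt_action At hAt hv (σt w'))
    (fun w' hw' κ' hκ' => by
      obtain ⟨c, hc⟩ := hpair w' hw'
      exact fderiv_action_eq_zero_of_pairing At hAt hv Qt hc κ' hκ')
    (hasFDerivAt_fderiv_action At hAt hv hu (σt w) hH)

/-- **THE HESSIAN READ THROUGH THE LINEARISED FIBRE LETTER IS THE NEXT-SCALE OPERATOR'S FORM**: if at `φ = σt w` the linearised field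
operator on the response pairs like a block lift — `Σ_x ((At(Dt k)) x + u′(φ x)·(Dt k) x)·h x = vol·Σ_y (Mt k) y·(Qt h) y` for all
`k h` (the fibre equation `P((A + N′)Dσ k) = 0` in pairing form, `Mt = Qt(At + u′(φ)·)Dt`) — and `Qt (Dt k′) = k′`, then
`(S″ φ).bilinearComp Dt Dt k k′ = vol·Σ_y (Mt k) y·k′ y`. [folklore] -/
theorem hessian_effectiveAction_apply_of_linearised (At : (ι → ℝ) →L[ℝ] (ι → ℝ)) {u' : ℝ → ℝ} {φ : ι → ℝ}
    {Dt : (κ → ℝ) →L[ℝ] (ι → ℝ)} (Qt : (ι → ℝ) →L[ℝ] (κ → ℝ)) (hsec : ∀ k : κ → ℝ, Qt (Dt k) = k)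
    {Mt : (κ → ℝ) →L[ℝ] (κ → ℝ)} {vol : ℝ}
    (hlin : ∀ (k : κ → ℝ) (h : ι → ℝ), ∑ x, (At (Dt k) x + u' (φ x) * Dt k x) * h x = vol * ∑ y, Mt k y * Qt h y)
    {H : (ι → ℝ) →L[ℝ] (ι → ℝ) →L[ℝ] ℝ} (hH : ∀ k k' : ι → ℝ, H k k' = ∑ x, (At k x + u' (φ x) * k x) * k' x)
    (k k' : κ → ℝ) :
    H.bilinearComp Dt Dt k k' = vol * ∑ y, Mt k y * k' y := by
  rw [ContinuousLinearMap.bilinearComp_apply, hH, hlin, hsec]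

/-- **ASSEMBLED**: under the hypotheses of `hasFDerivAt_fderiv_effectiveAction` and the linearised fibre letter at `w`, the second
derivative of the effective action exists at `w` and its value on `(k, k′)` is `vol·Σ_y (Mt k) y·k′ y`. [folklore] -/
theorem hessian_effectiveAction (At : (ι → ℝ) →L[ℝ] (ι → ℝ))
    (hAt : ∀ φ ψ : ι → ℝ, ∑ x, ψ x * At φ x = ∑ x, φ x * At ψ x)
    {v u u' : ℝ → ℝ} (hv : ∀ t, HasDerivAt v (u t) t) (hu : ∀ t, HasDerivAt u (u' t) t)
    (σt : (κ → ℝ) → (ι → ℝ)) {Dt : (κ → ℝ) → (κ → ℝ) →L[ℝ] (ι → ℝ)} (Qt : (ι → ℝ) →L[ℝ] (κ → ℝ))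
    {s : Set (κ → ℝ)} {w : κ → ℝ} (hs : s ∈ 𝓝 w)
    (hσ : ∀ w' ∈ s, HasFDerivAt σt (Dt w') w') (hsec : ∀ w' ∈ s, ∀ k : κ → ℝ, Qt (Dt w' k) = k) {vol : ℝ}
    (hpair : ∀ w' ∈ s, ∃ c : κ → ℝ, ∀ h : ι → ℝ, ∑ x, (At (σt w') x + u (σt w' x)) * h x = vol * ∑ y, c y * Qt h y)
    {Mt : (κ → ℝ) →L[ℝ] (κ → ℝ)}
    (hlin : ∀ (k : κ → ℝ) (h : ι → ℝ),
      ∑ x, (At (Dt w k) x + u' (σt w x) * Dt w k x) * h x = vol * ∑ y, Mt k y * Qt h y) :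
    ∃ H2 : (κ → ℝ) →L[ℝ] (κ → ℝ) →L[ℝ] ℝ,
      HasFDerivAt (fderiv ℝ ((fun φ : ι → ℝ => (1 / 2 : ℝ) * ∑ x, φ x * At φ x + ∑ x, v (φ x)) ∘ σt)) H2 w ∧
      ∀ k k' : κ → ℝ, H2 k k' = vol * ∑ y, Mt k y * k' y := by
  obtain ⟨H, hH⟩ := exists_clm_pairForm At (fun x => u' (σt w x))
  exact ⟨H.bilinearComp (Dt w) (Dt w), hasFDerivAt_fderiv_effectiveAction At hAt hv hu σt Qt hs hσ hsec hpair hH,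
    hessian_effectiveAction_apply_of_linearised At Qt (hsec w (mem_of_mem_nhds hs)) hlin hH⟩

/-! ## §5. Toy -/

/-- Toy: one fine site, one coarse site, `At = 0`, `v = u = 0`, `σt = id`, `Qt = Dt = 1`, `vol = 1`, `c = 0`: the effective action
is constant and its gradient is `1 • ⟨0, –⟩`. -/
example : HasFDerivAt (fun w' : Unit → ℝ => (1 / 2 : ℝ) * ∑ x, id w' x * (0 : (Unit → ℝ) →L[ℝ] (Unit → ℝ)) (id w') x
      + ∑ x, (fun _ : ℝ => (0 : ℝ)) (id w' x)) ((1 : ℝ) • (0 : (Unit → ℝ) →L[ℝ] ℝ)) (fun _ => 0) :=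
  hasFDerivAt_effectiveAction (ι := Unit) (κ := Unit) 0 (fun _ _ => by simp) (v := fun _ => 0) (u := fun _ => 0)
    (fun t => by simpa using hasDerivAt_const t (0 : ℝ)) id
    ((ContinuousLinearMap.id ℝ (Unit → ℝ)).hasFDerivAt) (ContinuousLinearMap.id ℝ (Unit → ℝ)) (fun _ => rfl)
    (c := fun _ => 0) (fun h => by simp) (fun k => by simp)

end Summit.QuantumFields.BalabanUV.T4Continuum.NE7b.SupTorusEffectiveAction

end
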